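import Summits.BirchSwinnertonDyer.BirchSwinnertonDyer.Theorems.ByReductionTypeAtTwoMultTransportP49KernelTwistKernel
import Summits.BirchSwinnertonDyer.BirchSwinnertonDyer.Theorems.ByReductionTypeAtTwoMultTransportP49KernelAssembly
import Literature.NumberTheory.EllipticCurves.ZpExtensionGaloisTwistRestrict
import Literature.NumberTheory.EllipticCurves.BigGaloisRepLocalInputs
import Literature.NumberTheory.IwasawaTheory.Greenberg2006.AlmostDivisibilityCriterion
import HarnessLib

/-!
# T-42-mult in the kernel, LIII — P49-KERNEL (11): the TWIST MODULE — `𝒜_S[θ_u][p^k] ≅ E[p^k](χ_u)` as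
# `G_{K,S}`-modules (evaluation at `0`), and the divisibility of `𝒜_S` by `θ_u` and of `𝒜_S[θ_u]` by `p^k`

Cell `bsd-2adic` (run/shared/lean/pub/bsd-2adic/), seat `bsd-2adic-t42` GEN 19 (pen RC-337; memo
`t42/DESIGN-T42-ADDENDUM-22` §A22.3 file (T)). HONEST FRAMING: research route; THEOREMS ONLY (no `def`, no named
fact, no instance, no `sorry`); nothing booked; BSD is not proved by any of this. PARTITION: X5@2 multiplicative
GV-transport rows (K4ᵐ B1·O1; input LEO of `P49Kernel.prop49_of_LEO`, p671196) × all p —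
reduces-the-named-input-of; bears_on K4 19922 / 19923 (`--supports stmt-BirchSwinnertonDyer-19923`).

## What

For a number field `K`, an elliptic `W/K`, a prime `p`, a `ℤ_p`-extension `κ`, `S ⊇ {v ∣ p}`, and a
continuous `ℤ_p`-linear model `ρ₀` of `E[p^∞] = PrimaryTorsion W.geomPoints p` over `G_{K,S}` with
`ρ₀(σ̄) P = σ • P`, let `𝒜_S = bigRep (κ.liftUnramifiedOutside S) ρ₀` (Greenberg's `Hom(Λ, E[p^∞])` with the
`κ̃⁻¹`-twisted action, LNM 1716 p. 115 — the module of `P49Kernel.prop49_of_LEO`) and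
`θ_u = C(u)T + C(u−1)`, `u ≡ 1 (mod p)`.
* **`exists_continuousAddEquiv_twistPiece`** — an equivariant continuous additive equivalence
  `𝒜_S[θ_u][p^k] ≃ (E[p^k](χ_u))^{N_S}` between the `Λ`-linear `G_{K,S}`-subrepresentation on the
  `p^k`-torsion of the `θ_u`-torsion and the `G_{K,S}`-module `quotientInvariants N_S` of the tree's twisted
  finite Galois module `W.twistedTorsionGaloisModule p κ k u hu = E[p^k](χ_u)`
  (`ZpExtensionGaloisTwistRestrict.lean`): evaluation at `0` (file LII: injective, onto `E[p^k]`, intertwining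
  `g` with `u^{κ(g) mod p^k} ρ₀(g)`; `N_S` acts trivially because `ρ₀` factors through `G_{K,S}`).
  This is Greenberg's «`𝒜[θ_s] ≅ E[p^∞] ⊗ κ^{−s} = A_{−s}` as `Gal(F_Σ/F)`-modules» at finite level.
* `twist_smul_surjective` — `θ_u` acts ONTO `𝒜_S` (coreflexive ⇒ divisible by non-zero scalars,
  `IsCoreflexive.smul_surjective`, `rfx_bigRepModule`);
* `exists_pow_smul_eq_zero_twistTorsion`, `pow_smul_surjective_twistTorsion` — `𝒜_S[θ_u]` is `p`-primary and
  `p^k`-divisible (`E(K̄)` is divisible: `smul_surjective_primaryTorsion`).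

References: [GreenbergLNM1716] §4 pp. 105, 115–116; [Greenberg2006] §2 C p. 353 (coreflexive ⇒ divisible).
-/

set_option autoImplicit false
set_option linter.dupNamespace false

noncomputable section

open scoped Classical

namespace Summit.BirchSwinnertonDyer.BirchSwinnertonDyer.Theorems.P49Kernel

open NumberField IsDedekindDomain Field WeierstrassCurve
  Literature.NumberTheory.EllipticCurves Literature.NumberTheory.EllipticCurves.BigRepModule
  Literature.NumberTheory.GaloisRepresentations
  Literature.NumberTheory.IwasawaTheory.Greenberg2006 Literature.NumberTheory.IwasawaTheory.Greenberg2016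

/-! ## §1. Arithmetic helpers -/

section Helpers

variable {p : ℕ} [Fact p.Prime]

omit [Fact p.Prime] in
/-- An integer `u ≡ 1 (mod p)` has an inverse `u' ≡ 1 (mod p)` modulo every `p^k`. [folklore] -/
theorem exists_inverse_mod_pow {u : ℤ} (hu : (p : ℤ) ∣ u - 1) (k : ℕ) :
    ∃ u' : ℤ, (p : ℤ) ∣ u' - 1 ∧ ((p : ℤ) ^ k) ∣ u * u' - 1 := by
  obtain ⟨m, hm⟩ := hu
  have hcop : IsCoprime u ((p : ℤ) ^ k) := by
    refine IsCoprime.pow_right ⟨1, -m, ?_⟩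
    linear_combination hm
  obtain ⟨a, b, hab⟩ := hcop
  cases k with
  | zero => exact ⟨1, by simp, by simp⟩
  | succ k =>
    refine ⟨a, ⟨-(a * m) - b * (p : ℤ) ^ k, ?_⟩, ⟨-b, ?_⟩⟩
    · linear_combination hab - a * hm
    · linear_combination hab

variable {K : Type} [Field K] (W : WeierstrassCurve K) [W.IsElliptic]

/-- `E[p^∞]` is divisible by every power of `p` (`E(K̄)` is divisible). [cite: SilvermanAEC2009, VIII.§2] -/
theorem exists_pow_smul_eq_primaryTorsion (k : ℕ) (a : PrimaryTorsion W.geomPoints p) :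
    ∃ b : PrimaryTorsion W.geomPoints p, p ^ k • b = a := by
  induction k generalizing a with
  | zero => exact ⟨a, by rw [pow_zero, one_smul]⟩
  | succ k ih =>
    obtain ⟨c, hc⟩ := W.smul_surjective_primaryTorsion p a
    obtain ⟨b, hb⟩ := ih c
    exact ⟨b, by rw [pow_succ, mul_smul, ← hc, ← hb, smul_comm]⟩

end Helpers

/-! ## §2. The twist module `𝒜_S[θ_u]`: divisibility -/

section Divisible

variable {K : Type} [Field K] [NumberField K] (S : Set (HeightOneSpectrum (𝓞 K))) (p : ℕ) [Fact p.Prime]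
  (W : WeierstrassCurve K) [W.IsElliptic] {u : ℤ}

/-- The coefficient of `T` in `θ_u` is `u ≠ 0`, so `θ_u ≠ 0`. [folklore] -/
theorem twistElement_ne_zero (hu : (p : ℤ) ∣ u - 1) :
    (PowerSeries.C ((u : ℤ_[p])) * PowerSeries.X + PowerSeries.C ((u : ℤ_[p]) - 1) : IwasawaAlgebra p) ≠ 0 := by
  intro h
  have h1 := congrArg (PowerSeries.coeff 1) h
  rw [map_add, PowerSeries.coeff_C, if_neg one_ne_zero, add_zero, mul_comm, PowerSeries.coeff_succ_X_mul,
    PowerSeries.coeff_zero_C, map_zero] at h1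
  have hu0 : (u : ℤ) ≠ 0 := by
    rintro rfl
    have : (p : ℤ) ∣ 1 := by simpa using hu
    exact (Fact.out : p.Prime).ne_one (by exact_mod_cast Int.eq_one_of_dvd_one (Int.natCast_nonneg p) this)
  exact hu0 (by exact_mod_cast h1)

omit [NumberField K] in
/-- **`θ_u` acts onto `𝒜 = E[p^∞] ⊗ Λ^*`** (coreflexive `Λ`-modules are divisible by non-zero scalars).
[cite: Greenberg2006, §2 C p. 353 L1–6] [cite: GreenbergLNM1716, §4 p. 116 (the sequence 0 → 𝒜[θ_s] → 𝒜 → 𝒜 → 0)] -/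
theorem twist_smul_surjective (hu : (p : ℤ) ∣ u - 1) :
    Function.Surjective fun Φ : BigRepModule ℤ_[p] p (PrimaryTorsion W.geomPoints p) ↦
      (PowerSeries.C ((u : ℤ_[p])) * PowerSeries.X + PowerSeries.C ((u : ℤ_[p]) - 1) : IwasawaAlgebra p) • Φ :=
  fun Φ ↦ (rfx_bigRepModule p W).smul_surjective (twistElement_ne_zero p hu) Φ

omit [NumberField K] [W.IsElliptic] in
/-- `𝒜[θ_u]` is `p`-primary (every element of `𝒜` is). [cite: GreenbergLNM1716, §4 p. 115] -/
theorem exists_pow_smul_eq_zero_twistTorsion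
    (d : Submodule.torsionBy (IwasawaAlgebra p) (BigRepModule ℤ_[p] p (PrimaryTorsion W.geomPoints p))
      (PowerSeries.C ((u : ℤ_[p])) * PowerSeries.X + PowerSeries.C ((u : ℤ_[p]) - 1) : IwasawaAlgebra p)) :
    ∃ k : ℕ, ((p : IwasawaAlgebra p) ^ k) • d = 0 := by
  obtain ⟨k, hk⟩ := BigRepModule.exists_pow_nsmul_eq_zero (d : BigRepModule ℤ_[p] p (PrimaryTorsion W.geomPoints p))
  refine ⟨k, Subtype.ext ?_⟩
  rw [Submodule.coe_smul, Submodule.coe_zero, ← Nat.cast_pow, Nat.cast_smul_eq_nsmul, hk]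

omit [NumberField K] in
/-- **`𝒜[θ_u]` is divisible by every `p^k`**: lift the value at `0` through `p^k` in the divisible `E[p^∞]`
and use the section of file LII; uniqueness on `𝒜[θ_u]` by the value at `0`.
[cite: GreenbergLNM1716, §4 p. 115 (𝒜[θ_s] ≅ A_{-s}, divisible)] -/
theorem pow_smul_surjective_twistTorsion (hu : (p : ℤ) ∣ u - 1) (k : ℕ) :
    Function.Surjective fun d : Submodule.torsionBy (IwasawaAlgebra p)
        (BigRepModule ℤ_[p] p (PrimaryTorsion W.geomPoints p))
        (PowerSeries.C ((u : ℤ_[p])) * PowerSeries.X + PowerSeries.C ((u : ℤ_[p]) - 1) : IwasawaAlgebra p) ↦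
      ((p : IwasawaAlgebra p) ^ k) • d := by
  rintro ⟨Φ, hΦ⟩
  have hΦ' := (Submodule.mem_torsionBy_iff _ Φ).mp hΦ
  -- torsion exponent of `Φ 0` and a `p^k`-th root of it
  obtain ⟨j, hj⟩ := (Φ 0).exists_pow_smul_eq_zero
  have hj' : p ^ j • Φ 0 = 0 := PrimaryTorsion.ext (by rw [PrimaryTorsion.val_nsmul, hj, PrimaryTorsion.val_zero])
  obtain ⟨b, hb⟩ := exists_pow_smul_eq_primaryTorsion W k (Φ 0)
  have hbj : p ^ (j + k) • b = 0 := by rw [pow_add, mul_smul, hb, hj']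
  obtain ⟨u', hu', huu'⟩ := exists_inverse_mod_pow hu (j + k)
  obtain ⟨Ψ, hΨθ, -, hΨ0⟩ := exists_torsionBy_twist_apply_zero_eq (A := PrimaryTorsion W.geomPoints p) hu' huu' b hbj
  refine ⟨⟨Ψ, (Submodule.mem_torsionBy_iff _ Ψ).mpr hΨθ⟩, Subtype.ext ?_⟩
  change ((p : IwasawaAlgebra p) ^ k) • Ψ = Φ
  refine eq_of_apply_zero_eq (by rw [smul_comm, hΨθ, smul_zero]) hΦ' ?_
  rw [← map_natCast (PowerSeries.C (R := ℤ_[p])), ← map_pow, C_smul, BigRepModule.smul_apply, hΨ0,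
    ← Nat.cast_pow, PrimaryTorsion.natCast_smul, hb]

end Divisible

/-! ## §3. `𝒜_S[θ_u][p^k] ≅ E[p^k](χ_u)` over `G_{K,S}` -/

section Iso

variable {K : Type} [Field K] [NumberField K] {S : Set (HeightOneSpectrum (𝓞 K))} {p : ℕ} [Fact p.Prime]
  (W : WeierstrassCurve K) (κ : ZpExtension K p)
  [TopologicalSpace (IwasawaAlgebra p)]
  (ρ₀ : ContinuousRep (GaloisGroupUnramifiedOutside K S) ℤ_[p] (PrimaryTorsion W.geomPoints p))
  {u : ℤ} (k : ℕ)

omit [Fact p.Prime] [NumberField K] in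
/-- Integer multiples commute with the coercion `E[p^∞] → E(K̄)`. [folklore] -/
theorem val_zsmul_primaryTorsion (z : ℤ) (a : PrimaryTorsion W.geomPoints p) :
    ((z • a : PrimaryTorsion W.geomPoints p) : W.geomPoints) = z • (a : W.geomPoints) := rfl

omit [NumberField K] [TopologicalSpace (IwasawaAlgebra p)] in
/-- `N_S` acts trivially on `E[p^∞]` when the action factors through `G_{K,S}`. [cite: Greenberg2006, p. 341 L39 – p. 342 L11] -/
theorem smul_eq_of_mem_ramificationSubgroup
    (hρ₀ : ∀ (σ : absoluteGaloisGroup K) (P : PrimaryTorsion W.geomPoints p), ρ₀ (toUnramifiedQuot K S σ) P = σ • P)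
    {n : absoluteGaloisGroup K} (hn : n ∈ ramificationSubgroup K S)
    (P : PrimaryTorsion W.geomPoints p) : n • P = P := by
  have h1 : toUnramifiedQuot K S n = 1 := (QuotientGroup.eq_one_iff n).mpr hn
  rw [← hρ₀ n P, h1, ← ContinuousRep.toRepresentation_apply, map_one, Module.End.one_apply]

omit [TopologicalSpace (IwasawaAlgebra p)] in
/-- `κ` vanishes on `N_S` when `S ⊇ {v ∣ p}` (it factors through `G_{K,S}`). [cite: Greenberg2006, p. 342 L2–4] -/
theorem kappa_eq_one_of_mem_ramificationSubgroup
    (hSp : ∀ v : HeightOneSpectrum (𝓞 K), ((p : ℕ) : 𝓞 K) ∈ v.asIdeal → v ∈ S)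
    {n : absoluteGaloisGroup K} (hn : n ∈ ramificationSubgroup K S) : κ n = 1 := by
  have h1 : toUnramifiedQuot K S n = 1 := (QuotientGroup.eq_one_iff n).mpr hn
  rw [← κ.liftUnramifiedOutside_mk S hSp n, h1, map_one]

omit [NumberField K] [TopologicalSpace (IwasawaAlgebra p)] in
/-- On `𝒜_S[θ_u]`: if `p^k` kills `Φ` then `p^k` kills `Φ(0)`. [folklore] -/
theorem pow_smul_apply_zero_eq_zero {Φ : BigRepModule ℤ_[p] p (PrimaryTorsion W.geomPoints p)}
    (hΦk : ((p : IwasawaAlgebra p) ^ k) • Φ = 0) : p ^ k • Φ 0 = 0 := by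
  have h := congrArg (fun Ψ : BigRepModule ℤ_[p] p (PrimaryTorsion W.geomPoints p) ↦ Ψ 0) hΦk
  simp only [BigRepModule.zero_apply] at h
  rwa [← map_natCast (PowerSeries.C (R := ℤ_[p])), ← map_pow, C_smul, BigRepModule.smul_apply, ← Nat.cast_pow,
    PrimaryTorsion.natCast_smul] at h

omit [NumberField K] [TopologicalSpace (IwasawaAlgebra p)] in
/-- The value at `0` of an element of `𝒜_S[θ_u][p^k]` is a geometric `p^k`-torsion point. [folklore] -/
theorem val_apply_zero_mem_geomTorsion {Φ : BigRepModule ℤ_[p] p (PrimaryTorsion W.geomPoints p)}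
    (hΦk : ((p : IwasawaAlgebra p) ^ k) • Φ = 0) :
    ((Φ 0 : PrimaryTorsion W.geomPoints p) : W.geomPoints) ∈ W.geomTorsion ((p ^ k : ℕ) : ℤ) := by
  show ((p ^ k : ℕ) : ℤ) • ((Φ 0 : PrimaryTorsion W.geomPoints p) : W.geomPoints) = 0
  rw [natCast_zsmul, ← PrimaryTorsion.val_nsmul, pow_smul_apply_zero_eq_zero W k hΦk, PrimaryTorsion.val_zero]

/-- **Evaluation at `0` intertwines the co-induced action with the twisted one, in `E(K̄)`**:
`((σ̄·Φ)(0) : E(K̄)) = u^{e_k(σ)} · σ · (Φ 0 : E(K̄))` for `Φ ∈ 𝒜_S[θ_u]` with `p^k Φ(0) = 0`, where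
`e_k = ZpExtension.twistExponent κ k` (file LII + `ρ₀(σ̄) = σ`). [cite: GreenbergLNM1716, §4 p. 115] -/
theorem val_bigRep_apply_zero
    (hSp : ∀ v : HeightOneSpectrum (𝓞 K), ((p : ℕ) : 𝓞 K) ∈ v.asIdeal → v ∈ S)
    (hρ₀ : ∀ (σ : absoluteGaloisGroup K) (P : PrimaryTorsion W.geomPoints p), ρ₀ (toUnramifiedQuot K S σ) P = σ • P)
    (hu : (p : ℤ) ∣ u - 1) {Φ : BigRepModule ℤ_[p] p (PrimaryTorsion W.geomPoints p)}
    (hΦ : (PowerSeries.C ((u : ℤ_[p])) * PowerSeries.X + PowerSeries.C ((u : ℤ_[p]) - 1) : IwasawaAlgebra p) • Φ = 0)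
    (hk : p ^ k • Φ 0 = 0) (σ : absoluteGaloisGroup K) :
    ((bigRep (κ.liftUnramifiedOutside S hSp) ρ₀ (toUnramifiedQuot K S σ) Φ 0 : PrimaryTorsion W.geomPoints p) :
        W.geomPoints) =
      (u ^ κ.twistExponent k σ) • σ • ((Φ 0 : PrimaryTorsion W.geomPoints p) : W.geomPoints) := by
  rw [bigRep_apply_zero_eq_pow_smul (κ.liftUnramifiedOutside S hSp) ρ₀ hu hΦ hk, hρ₀, ← Int.cast_pow,
    Int.cast_smul_eq_zsmul, val_zsmul_primaryTorsion, PrimaryTorsion.val_gsmul]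
  rfl

omit [TopologicalSpace (IwasawaAlgebra p)] in
/-- **Evaluation at `0`, `𝒜_S[θ_u][p^k] → (E[p^k](χ_u))^{N_S}`, is a bijective additive map** (file LII:
injective on `𝒜[θ_u]`, onto `E[p^k]`; `N_S` acts trivially on `E[p^k](χ_u)` because `ρ₀` and `κ` factor
through `G_{K,S}`). [cite: GreenbergLNM1716, §4 p. 115] -/
theorem exists_addMonoidHom_twistPiece
    (hSp : ∀ v : HeightOneSpectrum (𝓞 K), ((p : ℕ) : 𝓞 K) ∈ v.asIdeal → v ∈ S)
    (hρ₀ : ∀ (σ : absoluteGaloisGroup K) (P : PrimaryTorsion W.geomPoints p), ρ₀ (toUnramifiedQuot K S σ) P = σ • P)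
    (hu : (p : ℤ) ∣ u - 1) :
    ∃ F : (Submodule.torsionBy (IwasawaAlgebra p)
        (Submodule.torsionBy (IwasawaAlgebra p) (BigRepModule ℤ_[p] p (PrimaryTorsion W.geomPoints p))
          (PowerSeries.C ((u : ℤ_[p])) * PowerSeries.X + PowerSeries.C ((u : ℤ_[p]) - 1) : IwasawaAlgebra p))
        ((p : IwasawaAlgebra p) ^ k)) →+
        (Representation.invariants ((W.twistedTorsionGaloisModule p κ k u hu).toRepresentation.comp
          (ramificationSubgroup K S).subtype)),
      Function.Bijective F ∧
        ∀ y, (((F y : Representation.invariants ((W.twistedTorsionGaloisModule p κ k u hu).toRepresentation.comp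
          (ramificationSubgroup K S).subtype)) : W.geomTorsion ((p ^ k : ℕ) : ℤ)) : W.geomPoints) =
          (((y.1 : BigRepModule ℤ_[p] p (PrimaryTorsion W.geomPoints p)) 0 : PrimaryTorsion W.geomPoints p) :
            W.geomPoints) := by
  set θ : IwasawaAlgebra p := PowerSeries.C ((u : ℤ_[p])) * PowerSeries.X + PowerSeries.C ((u : ℤ_[p]) - 1)
    with hθ
  -- the two torsion conditions of an element `y` of the twist piece
  have hθy : ∀ y : Submodule.torsionBy (IwasawaAlgebra p)
      (Submodule.torsionBy (IwasawaAlgebra p) (BigRepModule ℤ_[p] p (PrimaryTorsion W.geomPoints p)) θ)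
      ((p : IwasawaAlgebra p) ^ k), θ • (y.1 : BigRepModule ℤ_[p] p (PrimaryTorsion W.geomPoints p)) = 0 :=
    fun y ↦ (Submodule.mem_torsionBy_iff θ (y.1 : BigRepModule ℤ_[p] p (PrimaryTorsion W.geomPoints p))).mp y.1.2
  have hky : ∀ y : Submodule.torsionBy (IwasawaAlgebra p)
      (Submodule.torsionBy (IwasawaAlgebra p) (BigRepModule ℤ_[p] p (PrimaryTorsion W.geomPoints p)) θ)
      ((p : IwasawaAlgebra p) ^ k),
      ((p : IwasawaAlgebra p) ^ k) • (y.1 : BigRepModule ℤ_[p] p (PrimaryTorsion W.geomPoints p)) = 0 := fun y ↦ by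
    have h := (Submodule.mem_torsionBy_iff ((p : IwasawaAlgebra p) ^ k) y.1).mp y.2
    rw [← Subtype.coe_inj, Submodule.coe_smul, Submodule.coe_zero] at h
    exact h
  have hinv : ∀ y : Submodule.torsionBy (IwasawaAlgebra p)
      (Submodule.torsionBy (IwasawaAlgebra p) (BigRepModule ℤ_[p] p (PrimaryTorsion W.geomPoints p)) θ)
      ((p : IwasawaAlgebra p) ^ k),
      (⟨_, val_apply_zero_mem_geomTorsion W k (hky y)⟩ : W.geomTorsion ((p ^ k : ℕ) : ℤ)) ∈
        Representation.invariants ((W.twistedTorsionGaloisModule p κ k u hu).toRepresentation.comp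
          (ramificationSubgroup K S).subtype) := by
    intro y
    rw [Representation.mem_invariants]
    intro n
    rw [MonoidHom.comp_apply, Subgroup.coe_subtype, ContinuousRep.toRepresentation_apply]
    apply Subtype.ext
    rw [ZpExtension.galoisTwist_apply_apply, torsionGaloisModule_apply_apply, ZpExtension.twistExponent,
      kappa_eq_one_of_mem_ramificationSubgroup κ hSp n.2, toAdd_one, map_zero, ZMod.val_zero, pow_zero,
      one_smul, AddSubgroup.torsionBy.coe_smul]
    rw [← PrimaryTorsion.val_gsmul, smul_eq_of_mem_ramificationSubgroup W ρ₀ hρ₀ n.2]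
  -- the additive map
  let F : Submodule.torsionBy (IwasawaAlgebra p)
      (Submodule.torsionBy (IwasawaAlgebra p) (BigRepModule ℤ_[p] p (PrimaryTorsion W.geomPoints p)) θ)
      ((p : IwasawaAlgebra p) ^ k) →+
      Representation.invariants ((W.twistedTorsionGaloisModule p κ k u hu).toRepresentation.comp
        (ramificationSubgroup K S).subtype) :=
    { toFun := fun y ↦ ⟨⟨_, val_apply_zero_mem_geomTorsion W k (hky y)⟩, hinv y⟩
      map_zero' := rfl
      map_add' := fun _ _ ↦ rfl }
  have hF : ∀ y, (((F y : Representation.invariants _) : W.geomTorsion ((p ^ k : ℕ) : ℤ)) : W.geomPoints) =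
      (((y.1 : BigRepModule ℤ_[p] p (PrimaryTorsion W.geomPoints p)) 0 : PrimaryTorsion W.geomPoints p) :
        W.geomPoints) := fun _ ↦ rfl
  refine ⟨F, ⟨?_, ?_⟩, hF⟩
  · intro y y' h
    have h' := congrArg (fun w : Representation.invariants ((W.twistedTorsionGaloisModule p κ k u hu).toRepresentation.comp
      (ramificationSubgroup K S).subtype) ↦ ((w : W.geomTorsion ((p ^ k : ℕ) : ℤ)) : W.geomPoints)) h
    simp only [hF] at h'
    exact Subtype.ext (Subtype.ext (eq_of_apply_zero_eq (hθy y) (hθy y') (PrimaryTorsion.ext h')))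
  · intro w
    have hw : ((p ^ k : ℕ) : ℤ) • (((w : W.geomTorsion ((p ^ k : ℕ) : ℤ)) : W.geomPoints)) = 0 :=
      (w : W.geomTorsion ((p ^ k : ℕ) : ℤ)).2
    have hw' : p ^ k • (((w : W.geomTorsion ((p ^ k : ℕ) : ℤ)) : W.geomPoints)) = 0 := by
      rwa [natCast_zsmul] at hw
    have hka : p ^ k • (PrimaryTorsion.mk _ k hw' : PrimaryTorsion W.geomPoints p) = 0 :=
      PrimaryTorsion.ext (by rw [PrimaryTorsion.val_nsmul, PrimaryTorsion.val_mk, PrimaryTorsion.val_zero, hw'])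
    obtain ⟨u', hu', huu'⟩ := exists_inverse_mod_pow hu k
    obtain ⟨Ψ, hΨθ, hΨk, hΨ0⟩ :=
      exists_torsionBy_twist_apply_zero_eq (A := PrimaryTorsion W.geomPoints p) hu' huu' _ hka
    refine ⟨⟨⟨Ψ, (Submodule.mem_torsionBy_iff θ Ψ).mpr hΨθ⟩,
      (Submodule.mem_torsionBy_iff ((p : IwasawaAlgebra p) ^ k) _).mpr (Subtype.ext hΨk)⟩, ?_⟩
    apply Subtype.ext; apply Subtype.ext
    rw [hF]
    change ((Ψ 0 : PrimaryTorsion W.geomPoints p) : W.geomPoints) = _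
    rw [hΨ0, PrimaryTorsion.val_mk]

/-- **`𝒜_S[θ_u][p^k] ≅ (E[p^k](χ_u))^{N_S}` as `G_{K,S}`-modules** (equivariant continuous additive
equivalence, evaluation at `0`). Source: the `Λ`-linear subrepresentation of
`𝒜_S = bigRep (κ.liftUnramifiedOutside S) ρ₀` on the `p^k`-torsion of its `θ_u`-torsion; target: the
`G_{K,S} = Γ_K ⧸ N_S`-module of `N_S`-invariants of the twisted finite Galois module
`W.twistedTorsionGaloisModule p κ k u hu` (all of it). Greenberg: «`𝒜[θ_s] ≅ Hom(ℤ_p(κ^s), E[p^∞]) ≅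
E[p^∞] ⊗ (κ^{−s}) = A_{−s}` as `Gal(F_Σ/F)`-modules» (p. 115). [cite: GreenbergLNM1716, §4 p. 115] -/
theorem exists_continuousAddEquiv_twistPiece
    (hSp : ∀ v : HeightOneSpectrum (𝓞 K), ((p : ℕ) : 𝓞 K) ∈ v.asIdeal → v ∈ S)
    (hρ₀ : ∀ (σ : absoluteGaloisGroup K) (P : PrimaryTorsion W.geomPoints p), ρ₀ (toUnramifiedQuot K S σ) P = σ • P)
    (hu : (p : ℤ) ∣ u - 1) :
    ∃ η : (Submodule.torsionBy (IwasawaAlgebra p)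
        (Submodule.torsionBy (IwasawaAlgebra p) (BigRepModule ℤ_[p] p (PrimaryTorsion W.geomPoints p))
          (PowerSeries.C ((u : ℤ_[p])) * PowerSeries.X + PowerSeries.C ((u : ℤ_[p]) - 1) : IwasawaAlgebra p))
        ((p : IwasawaAlgebra p) ^ k)) ≃ₜ+
        (Representation.invariants ((W.twistedTorsionGaloisModule p κ k u hu).toRepresentation.comp
          (ramificationSubgroup K S).subtype)),
      ∀ (g : GaloisGroupUnramifiedOutside K S)
        (y : Submodule.torsionBy (IwasawaAlgebra p)
          (Submodule.torsionBy (IwasawaAlgebra p) (BigRepModule ℤ_[p] p (PrimaryTorsion W.geomPoints p))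
            (PowerSeries.C ((u : ℤ_[p])) * PowerSeries.X + PowerSeries.C ((u : ℤ_[p]) - 1) : IwasawaAlgebra p))
          ((p : IwasawaAlgebra p) ^ k)),
        η ((((bigRep (κ.liftUnramifiedOutside S hSp) ρ₀).subrepresentation
              (Submodule.torsionBy (IwasawaAlgebra p) (BigRepModule ℤ_[p] p (PrimaryTorsion W.geomPoints p))
                (PowerSeries.C ((u : ℤ_[p])) * PowerSeries.X + PowerSeries.C ((u : ℤ_[p]) - 1) : IwasawaAlgebra p))
              ((bigRep (κ.liftUnramifiedOutside S hSp) ρ₀).torsionBy_smul_le_comap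
                (PowerSeries.C ((u : ℤ_[p])) * PowerSeries.X + PowerSeries.C ((u : ℤ_[p]) - 1) :
                  IwasawaAlgebra p))).subrepresentation
            (Submodule.torsionBy (IwasawaAlgebra p)
              (Submodule.torsionBy (IwasawaAlgebra p) (BigRepModule ℤ_[p] p (PrimaryTorsion W.geomPoints p))
                (PowerSeries.C ((u : ℤ_[p])) * PowerSeries.X + PowerSeries.C ((u : ℤ_[p]) - 1) : IwasawaAlgebra p))
              ((p : IwasawaAlgebra p) ^ k))
            (((bigRep (κ.liftUnramifiedOutside S hSp) ρ₀).subrepresentation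
              (Submodule.torsionBy (IwasawaAlgebra p) (BigRepModule ℤ_[p] p (PrimaryTorsion W.geomPoints p))
                (PowerSeries.C ((u : ℤ_[p])) * PowerSeries.X + PowerSeries.C ((u : ℤ_[p]) - 1) : IwasawaAlgebra p))
              ((bigRep (κ.liftUnramifiedOutside S hSp) ρ₀).torsionBy_smul_le_comap
                (PowerSeries.C ((u : ℤ_[p])) * PowerSeries.X + PowerSeries.C ((u : ℤ_[p]) - 1) :
                  IwasawaAlgebra p))).torsionBy_smul_le_comap
              ((p : IwasawaAlgebra p) ^ k))) g y) =
          (W.twistedTorsionGaloisModule p κ k u hu).quotientInvariants (ramificationSubgroup K S) g (η y) := by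
  obtain ⟨F, hFbij, hF⟩ := exists_addMonoidHom_twistPiece W κ ρ₀ k hSp hρ₀ hu
  let η : Submodule.torsionBy (IwasawaAlgebra p)
      (Submodule.torsionBy (IwasawaAlgebra p) (BigRepModule ℤ_[p] p (PrimaryTorsion W.geomPoints p))
        (PowerSeries.C ((u : ℤ_[p])) * PowerSeries.X + PowerSeries.C ((u : ℤ_[p]) - 1) : IwasawaAlgebra p))
      ((p : IwasawaAlgebra p) ^ k) ≃ₜ+
      Representation.invariants ((W.twistedTorsionGaloisModule p κ k u hu).toRepresentation.comp
        (ramificationSubgroup K S).subtype) :=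
    { AddEquiv.ofBijective F hFbij with
      continuous_toFun := continuous_of_discreteTopology
      continuous_invFun := continuous_of_discreteTopology }
  have hη : ∀ y, η y = F y := fun _ ↦ rfl
  refine ⟨η, fun g y ↦ ?_⟩
  induction g using QuotientGroup.induction_on with
  | H σ =>
    rw [hη, hη]
    apply Subtype.ext; apply Subtype.ext
    rw [hF]
    -- right: the twisted action; left: the co-induced action read at `0`
    conv_rhs => rw [DiscreteGaloisModule.quotientInvariants_apply_coe, ZpExtension.galoisTwist_apply_apply,
      torsionGaloisModule_apply_apply, AddSubgroup.coe_zsmul, AddSubgroup.torsionBy.coe_smul, hF]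
    have hθy : (PowerSeries.C ((u : ℤ_[p])) * PowerSeries.X + PowerSeries.C ((u : ℤ_[p]) - 1) : IwasawaAlgebra p) •
        (y.1 : BigRepModule ℤ_[p] p (PrimaryTorsion W.geomPoints p)) = 0 :=
      (Submodule.mem_torsionBy_iff _ (y.1 : BigRepModule ℤ_[p] p (PrimaryTorsion W.geomPoints p))).mp y.1.2
    have hky : ((p : IwasawaAlgebra p) ^ k) • (y.1 : BigRepModule ℤ_[p] p (PrimaryTorsion W.geomPoints p)) = 0 := by
      have h := (Submodule.mem_torsionBy_iff ((p : IwasawaAlgebra p) ^ k) y.1).mp y.2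
      rw [← Subtype.coe_inj, Submodule.coe_smul, Submodule.coe_zero] at h
      exact h
    exact val_bigRep_apply_zero W κ ρ₀ k hSp hρ₀ hu hθy (pow_smul_apply_zero_eq_zero W k hky) σ

end Iso

end Summit.BirchSwinnertonDyer.BirchSwinnertonDyer.Theorems.P49Kernel

end
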